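import Literature.MathematicalPhysics.QuantumFieldTheory.Balaban1983to89.B14Eq350Kernel
import Literature.MathematicalPhysics.QuantumFieldTheory.Balaban1983to89.B12Ward414

/-!
# `Balaban1983to89.B14.Lem280Ward` — T. Bałaban, *Convergent renormalization expansions for lattice gauge theories*,
# Commun. Math. Phys. **119** (1988) 243–285 [Balaban1988Convergent]: the antisymmetry property (3.51) and its proof
# (3.52)–(3.54) *"by the first identity (I.4.15)"* (pp. 280–281), the antisymmetries (3.55) of the moment table, and the
# first Ward–Takahashi identity (I.4.15)₁ IN KERNEL FORM derived from [I]'s abstract identity — all PROVED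

statement-level skeleton of published theorems with citation tags; proofs where landed; nothing here is a claim about the Yang–Mills mass gap

PDF held: `paper:balaban1988-cmp119-convergent-renormalization` (journal page = PDF page + 242); pp. 280–281 [PDF 38–39] read
from the OCR text layer (`lit read`) and, for the displays, from the x2 renders `…-p038-x2.png`, `…-p039-x2.png` of the cell
`pub-balaban` (symbols of (3.51)–(3.55) as transcribed in `B14Sect3` §C/§E, whose author read the same renders); [I] =
[Balaban1987RG1] (4.15) p. 284 quoted from the module docstring of `B12Ward414`/`B12WardSecond415` (cell reading of the render
`1987-cmp109-rg-I-small-field-p036-x2.png`).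

CITATION HEADER (lean-in-tree rule).  WHAT IS REPRODUCED, verbatim.  [Balaban1988Convergent] p. 280: *"In particular
𝐄^{(2)}_{μν}(X, x, y, z) = (δ/δB_μ(x))(δ/δB_ν(y))𝐄^{(j)}(X, U_j(exp iB), z)|_{B=0}. (3.50) This implies 𝐄^{(2)}_{μν}(X, x, y, z) =
𝐄^{(2)}_{νμ}(X, y, x, z). We prove the following antisymmetry property Σ_x 𝐄^{(2)}_{μν}(X, x, y, z)(x_κ − z_κ) = −Σ_x
𝐄^{(2)}_{κν}(X, x, y, z)(x_μ − z_μ). (3.51)"*; p. 281: *"Let us suppress the other symbols and denote the left-hand side above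
by E_{μκ}. We decompose it into the symmetric and antisymmetric parts … We have to prove that the symmetric part is equal to
0. Take the scalar product with an arbitrary matrix A, tr AE^{(s)} = tr A^{(s)}E, where A^{(s)} is the symmetric part of A.
Thus tr AE^{(s)} = Σ_{x,μ,κ} 𝐄^{(2)}_{μν}(X, x, y, z)A^{(s)}_{μκ}(x_κ − z_κ). (3.52) Take the function λ(x) = ½Σ_{μ,κ}A^{(s)}_{μκ}
(x_μ − z_μ)(x_κ − z_κ) − Σ_μ A^{(s)}_{μμ}(x_μ − z_μ). (3.53) Of course (∂_μλ)(x) = Σ_κ A^{(s)}_{μκ}(x_κ − z_κ), hence tr AE^{(s)} =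
Σ_{x,μ}(∂_μλ)(x)𝐄^{(2)}_{μν}(X, x, y, z) = 0 (3.54) by the first identity (I.4.15). Because A is an arbitrary matrix, so the
above equalities imply E^{(s)} = 0, which is the property (3.51). Denoting by 𝐄^{(2)}_{μν,κλ}(X, z) the sum over x, y in the
square bracket in (3.49), we have 𝐄^{(2)}_{μν,κλ}(X, z) = −𝐄^{(2)}_{κν,μλ}(X, z) = −𝐄^{(2)}_{μλ,κν}(X, z). (3.55) This property
allows us to antisymmetrize the derivatives in (3.49) in the indices μ, κ and ν, λ."*  [Balaban1987RG1] p. 284, (4.15), first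
identity: *"⟨(δ²/δB²)𝐄(1), B₁, ∂λ⟩ = 0 … for an arbitrary gauge function λ, and arbitrary gauge fields B₁"*; (4.14):
*"(δ/δB)𝐄(1) = 0"*; p. 283 (4.9): *"… It is the fundamental identity expressing the gauge invariance of the function 𝐄"*.

SKELETON rows (owner r11): **B14.Lem@280** (the antisymmetry (3.51) with its proof (3.52)–(3.54); status so far
`proved-existing (abstract)` = `B14Sect3.antisymm_of_pairing_symm_zero`, whose HYPOTHESIS is the vanishing (3.54) of the
pairing with every symmetric matrix — *"The input (I.4.15) … is NOT reproduced"*), **B14.Eq3.55–3.57** ((3.55) so far a pair of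
HYPOTHESES `h355a`/`h355b` of `B14.Eq350Kernel.eq356_of_eq349` and `hE₁`/`hE₂` of `B14.Eq356FieldStrength.eq356`),
**B14.Eq3.49–3.50**.  THIS FILE closes both gaps down to the printed input (I.4.15)₁:

* §1 (3.53) ⇒ (3.54) ⇒ (3.51): for a two-point kernel table `K_{μν}(x, y)` (= `𝐄^{(2)}_{μν}(X, x, y, z)`, `z` fixed) on a
  finite window `W` of lattice points (the bonds of the localization domain `X ⊂ □^{∼2}`, first case of p. 279), a lattice
  shift `x ↦ x + e_μ` (`shift μ`) and coordinates affine along it on `W` (`coord (shift μ x) κ = coord x κ + ξδ_{κμ}`, `ξ ≠ 0`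
  the lattice spacing), the first Ward–Takahashi identity (I.4.15)₁ IN KERNEL FORM in the `x`-slot — `Σ_{x∈W}Σ_μ K_{μν}(x, y)
  (λ(x + e_μ) − λ(x)) = 0` for every gauge function `λ` and every `(ν, y)` (`hW`) — gives (3.54) for every symmetric `A`
  (`eq354`, the gauge function being (3.53) with the corrected linear coefficient, `B14Sect3.fwdDiff_lam353_half`), hence
  (3.51) (`eq351`, via `B14Sect3.antisymm_of_pairing_symm_zero`), hence the first antisymmetry of (3.55) for the moment table
  `B14.Eq356FieldStrength.moment2 (W ×ˢ W) K coord z` (`eq355a`); the second antisymmetry from (I.4.15)₁ in the `y`-slot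
  (`eq355b`), which itself follows from the `x`-slot identity and the symmetry after (3.50) (`wardY_of_wardX_symm`,
  `eq355b_of_symm`); consequence `eq356_of_eq349_of_ward` = `eq356_of_eq349` with (3.55) DISCHARGED.
* §2 (I.4.15)₁ in kernel form FROM [I]: for the scalar-component functional `F : (Fin d × T → ℝ) → ℝ` of a bond field on a
  finite configuration index `T` (a torus or box carrying `X`), twice continuously differentiable at `B = 0`, the second
  derivative on coordinate directions is the kernel sum (`hessian_single_apply`, `hessian_apply_single`: `D²F(0)[δ_{(μ,x)},
  w] = Σ_{y,ν} 𝐄^{(2)}_{μν}(x, y)w_ν(y)` for the printed kernel `B14.Eq350Kernel.kernel350 F`); so [I]'s ABSTRACT (4.15)₁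
  `B12Ward414.hessian_apply_generator_eq_zero` — a generator field `X_λ` of the gauge action with `X_λ(0) = c·∂λ` (print:
  `c = −1`, (4.8)–(4.9)), infinitesimal invariance `DF(B)[X_λ(B)] = 0` near `B = 0` ((4.9)) and (4.14) `DF(0) = 0` — yields
  the kernel form in the `y`-slot (`wardY_kernel350`) and, by `B12Ward414.hessian_generator_apply_eq_zero`, in the `x`-slot
  (`wardX_kernel350`); for the LINEAR (abelian / linearized) action `B ↦ B + t∂λ` no (4.14) is needed
  (`wardY_kernel350_of_translate`, via `B12Ward414.ward_first_order`).  Window forms under the locality of the kernel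
  (`𝐄^{(2)}_{μν}(X, x, y, z) = 0` unless `x, y ∈ W`): `wardX_window`, and the assembled **`eq355_kernel350_of_ward`** — (3.51)
  and both antisymmetries (3.55) for `K = kernel350 F` from gauge invariance in [I]'s abstract form.
Model notes (declared): (M1) scalar bond-field components, as in `B14.Eq350Kernel` §2 (the trace-form reduction of the
𝔤⊗𝔤-valued kernel, [I] (4.33), is not reproduced); (M2) the window `W` with affine coordinates = a domain not meeting the
seam of the torus (p. 279 *"X ⊂ □^{∼2}"*); (M3) `ξ` = the lattice spacing of `L^{−j}Z^d` in the chosen units — only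
`ξ ≠ 0` matters for identities `= 0`.  Theorems only; no `def`, no `sorry`.

Mega-formalization `lit-balaban`, unit `lit-balaban-r11` gen 5 (B14 fold owner), HOME `run/shared/lean/pub/lit-balaban/`.

## References
* [Balaban1988Convergent] T. Bałaban, Commun. Math. Phys. 119 (1988) 243–285, (3.49)–(3.55) pp. 280–281.
* [Balaban1987RG1] T. Bałaban, Commun. Math. Phys. 109 (1987) 249–301 ([I]: (4.7)–(4.9) pp. 282–283, (4.14)–(4.15) p. 284).
-/

namespace Literature.MathematicalPhysics.QuantumFieldTheory.Balaban1983to89.B14.Lem280Ward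

open Finset
open _root_.Filter _root_.Topology
open Literature.MathematicalPhysics.QuantumFieldTheory.Balaban1983to89
open Literature.MathematicalPhysics.QuantumFieldTheory.Balaban1983to89.B14.Eq356FieldStrength (moment2)
open Literature.MathematicalPhysics.QuantumFieldTheory.Balaban1983to89.B14.Eq350Kernel

/-! ## §1. (3.53) ⇒ (3.54) ⇒ (3.51) ⇒ (3.55) from the first Ward–Takahashi identity in kernel form -/

section KernelAlgebra

variable {d : ℕ} {X : Type*}

/-- **(3.53) and "Of course (∂_μλ)(x) = Σ_κ A^{(s)}_{μκ}(x_κ − z_κ)"** (p. 281) along the lattice shift: for symmetric `A` the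
quadratic gauge function `λ(x) = λ_{½ξ}(x − z)` of (3.53) (`B14Sect3.lam353` with the corrected linear coefficient `ξ/2`) has the
lattice gradient `λ(x + e_μ) − λ(x) = ξ Σ_κ A_{μκ}(x_κ − z_κ)` wherever the coordinates are affine along the shift.
[cite: Balaban1988Convergent, (3.53) p.281] -/
theorem grad_quadratic (A : Fin d → Fin d → ℝ) (hA : ∀ μ κ, A μ κ = A κ μ) {ξ : ℝ} (hξ : ξ ≠ 0)
    (coord : X → Fin d → ℝ) (shift : Fin d → X → X) (z x : X) (μ : Fin d)
    (hco : ∀ κ, coord (shift μ x) κ = coord x κ + if κ = μ then ξ else 0) :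
    B14Sect3.lam353 A (ξ / 2) (fun i => coord (shift μ x) i - coord z i)
      - B14Sect3.lam353 A (ξ / 2) (fun i => coord x i - coord z i)
      = ξ * ∑ κ, A μ κ * (coord x κ - coord z κ) := by
  have hu : (fun i => coord (shift μ x) i - coord z i)
      = (fun i => coord x i - coord z i) + ξ • B14Sect3.bvec μ := by
    funext i
    simp only [Pi.add_apply, Pi.smul_apply, B14Sect3.bvec, smul_eq_mul, hco i]
    split_ifs <;> ring
  have h := B14Sect3.fwdDiff_lam353_half A hA ξ hξ (fun i => coord x i - coord z i) μ
  rw [hu]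
  have h' : ξ * (ξ⁻¹ * (B14Sect3.lam353 A (ξ / 2) ((fun i => coord x i - coord z i) + ξ • B14Sect3.bvec μ)
      - B14Sect3.lam353 A (ξ / 2) (fun i => coord x i - coord z i)))
      = ξ * ∑ κ, A μ κ * (coord x κ - coord z κ) := by rw [h]
  rw [← mul_assoc, mul_inv_cancel₀ hξ, one_mul] at h'
  exact h'

/-- **(3.52)–(3.54)** (p. 281): *"tr AE^{(s)} = Σ_{x,μ,κ} 𝐄^{(2)}_{μν}(X, x, y, z)A^{(s)}_{μκ}(x_κ − z_κ) (3.52) … = Σ_{x,μ}(∂_μλ)(x)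
𝐄^{(2)}_{μν}(X, x, y, z) = 0 (3.54) by the first identity (I.4.15)"* — for every SYMMETRIC matrix `A`, every `ν` and `y`:
`Σ_{μ,κ} A_{μκ} Σ_{x∈W} K_{μν}(x, y)(x_κ − z_κ) = 0`, from (I.4.15)₁ in kernel form in the `x`-slot (`hW`) applied to the gauge
function (3.53). [cite: Balaban1988Convergent, (3.52)–(3.54) p.281] -/
theorem eq354 (K : Fin d → Fin d → X → X → ℝ) (W : Finset X) (shift : Fin d → X → X)
    (coord : X → Fin d → ℝ) (z : X) {ξ : ℝ} (hξ : ξ ≠ 0)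
    (hco : ∀ x ∈ W, ∀ μ κ, coord (shift μ x) κ = coord x κ + if κ = μ then ξ else 0)
    (hW : ∀ (lam : X → ℝ) (ν : Fin d) (y : X), ∑ x ∈ W, ∑ μ, K μ ν x y * (lam (shift μ x) - lam x) = 0)
    (A : Fin d → Fin d → ℝ) (hA : ∀ μ κ, A μ κ = A κ μ) (ν : Fin d) (y : X) :
    ∑ μ, ∑ κ, A μ κ * ∑ x ∈ W, K μ ν x y * (coord x κ - coord z κ) = 0 := by
  have h0 := hW (fun x => B14Sect3.lam353 A (ξ / 2) (fun i => coord x i - coord z i)) ν y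
  have h2 : ∑ x ∈ W, ∑ μ, K μ ν x y *
        (B14Sect3.lam353 A (ξ / 2) (fun i => coord (shift μ x) i - coord z i)
          - B14Sect3.lam353 A (ξ / 2) (fun i => coord x i - coord z i))
      = ∑ x ∈ W, ∑ μ, ∑ κ, ξ * (A μ κ * (K μ ν x y * (coord x κ - coord z κ))) := by
    refine Finset.sum_congr rfl fun x hx => Finset.sum_congr rfl fun μ _ => ?_
    rw [grad_quadratic A hA hξ coord shift z x μ (hco x hx μ), Finset.mul_sum, Finset.mul_sum]
    exact Finset.sum_congr rfl fun κ _ => by ring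
  have h3 : ∑ x ∈ W, ∑ μ, ∑ κ, ξ * (A μ κ * (K μ ν x y * (coord x κ - coord z κ)))
      = ξ * ∑ μ, ∑ κ, A μ κ * ∑ x ∈ W, K μ ν x y * (coord x κ - coord z κ) := by
    calc ∑ x ∈ W, ∑ μ, ∑ κ, ξ * (A μ κ * (K μ ν x y * (coord x κ - coord z κ)))
        = ∑ μ, ∑ x ∈ W, ∑ κ, ξ * (A μ κ * (K μ ν x y * (coord x κ - coord z κ))) := Finset.sum_comm
      _ = ∑ μ, ∑ κ, ∑ x ∈ W, ξ * (A μ κ * (K μ ν x y * (coord x κ - coord z κ))) :=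
          Finset.sum_congr rfl fun μ _ => Finset.sum_comm
      _ = ξ * ∑ μ, ∑ κ, A μ κ * ∑ x ∈ W, K μ ν x y * (coord x κ - coord z κ) := by
          rw [Finset.mul_sum]
          refine Finset.sum_congr rfl fun μ _ => ?_
          rw [Finset.mul_sum]
          refine Finset.sum_congr rfl fun κ _ => ?_
          rw [Finset.mul_sum, Finset.mul_sum]
  rw [h2, h3] at h0
  exact (mul_eq_zero.1 h0).resolve_left hξ

/-- **(3.51)** (p. 280): *"Σ_x 𝐄^{(2)}_{μν}(X, x, y, z)(x_κ − z_κ) = −Σ_x 𝐄^{(2)}_{κν}(X, x, y, z)(x_μ − z_μ)"* — PROVED from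
(I.4.15)₁ in kernel form (`hW`) via (3.54) and *"Because A is an arbitrary matrix, so the above equalities imply E^{(s)} = 0"*
(`B14Sect3.antisymm_of_pairing_symm_zero`). [cite: Balaban1988Convergent, (3.51) p.280] -/
theorem eq351 (K : Fin d → Fin d → X → X → ℝ) (W : Finset X) (shift : Fin d → X → X)
    (coord : X → Fin d → ℝ) (z : X) {ξ : ℝ} (hξ : ξ ≠ 0)
    (hco : ∀ x ∈ W, ∀ μ κ, coord (shift μ x) κ = coord x κ + if κ = μ then ξ else 0)
    (hW : ∀ (lam : X → ℝ) (ν : Fin d) (y : X), ∑ x ∈ W, ∑ μ, K μ ν x y * (lam (shift μ x) - lam x) = 0)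
    (ν : Fin d) (y : X) (μ κ : Fin d) :
    ∑ x ∈ W, K μ ν x y * (coord x κ - coord z κ) = -∑ x ∈ W, K κ ν x y * (coord x μ - coord z μ) :=
  B14Sect3.antisymm_of_pairing_symm_zero (fun a b => ∑ x ∈ W, K b ν x y * (coord x a - coord z a))
    (fun A hA => eq354 K W shift coord z hξ hco hW A hA ν y) κ μ

/-- The moment table with the two lattice slots of the kernel exchanged is the moment table with both index pairs exchanged
(re-indexing the double sum). [cite: Balaban1988Convergent, (3.55) p.281] -/
theorem moment2_swap (K : Fin d → Fin d → X → X → ℝ) (W : Finset X) (coord : X → Fin d → ℝ) (z : X)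
    (μ ν κ τ : Fin d) :
    moment2 (W ×ˢ W) (fun a b y x => K b a x y) coord z ν μ τ κ = moment2 (W ×ˢ W) K coord z μ ν κ τ := by
  simp only [moment2]
  rw [Finset.sum_product, Finset.sum_product, Finset.sum_comm]
  exact Finset.sum_congr rfl fun x _ => Finset.sum_congr rfl fun y _ => by ring

/-- **(3.55), first antisymmetry** (p. 281): `𝐄^{(2)}_{μν,κλ}(X, z) = −𝐄^{(2)}_{κν,μλ}(X, z)` for the moment table
`𝐄^{(2)}_{μν,κλ}(X, z) = Σ_{x,y∈W} 𝐄^{(2)}_{μν}(X, x, y, z)(x_κ − z_κ)(y_λ − z_λ)` (`B14.Eq356FieldStrength.moment2` on the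
window `W ×ˢ W`) — PROVED from (3.51), i.e. from (I.4.15)₁ in the `x`-slot. [cite: Balaban1988Convergent, (3.55) p.281] -/
theorem eq355a (K : Fin d → Fin d → X → X → ℝ) (W : Finset X) (shift : Fin d → X → X)
    (coord : X → Fin d → ℝ) (z : X) {ξ : ℝ} (hξ : ξ ≠ 0)
    (hco : ∀ x ∈ W, ∀ μ κ, coord (shift μ x) κ = coord x κ + if κ = μ then ξ else 0)
    (hW : ∀ (lam : X → ℝ) (ν : Fin d) (y : X), ∑ x ∈ W, ∑ μ, K μ ν x y * (lam (shift μ x) - lam x) = 0)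
    (μ ν κ τ : Fin d) :
    moment2 (W ×ˢ W) K coord z μ ν κ τ = -moment2 (W ×ˢ W) K coord z κ ν μ τ := by
  simp only [moment2]
  rw [Finset.sum_product, Finset.sum_product]
  calc ∑ x ∈ W, ∑ y ∈ W, K μ ν x y * (coord x κ - coord z κ) * (coord y τ - coord z τ)
      = ∑ y ∈ W, (coord y τ - coord z τ) * ∑ x ∈ W, K μ ν x y * (coord x κ - coord z κ) := by
        rw [Finset.sum_comm]
        refine Finset.sum_congr rfl fun y _ => ?_
        rw [Finset.mul_sum]
        exact Finset.sum_congr rfl fun x _ => by ring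
    _ = ∑ y ∈ W, (coord y τ - coord z τ) * -∑ x ∈ W, K κ ν x y * (coord x μ - coord z μ) :=
        Finset.sum_congr rfl fun y _ => by rw [eq351 K W shift coord z hξ hco hW ν y μ κ]
    _ = -∑ y ∈ W, ∑ x ∈ W, K κ ν x y * (coord x μ - coord z μ) * (coord y τ - coord z τ) := by
        rw [← Finset.sum_neg_distrib]
        refine Finset.sum_congr rfl fun y _ => ?_
        rw [mul_neg, Finset.mul_sum, ← Finset.sum_neg_distrib, ← Finset.sum_neg_distrib]
        exact Finset.sum_congr rfl fun x _ => by ring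
    _ = -∑ x ∈ W, ∑ y ∈ W, K κ ν x y * (coord x μ - coord z μ) * (coord y τ - coord z τ) := by
        rw [Finset.sum_comm]

/-- **(3.55), second antisymmetry** (p. 281): `𝐄^{(2)}_{μν,κλ}(X, z) = −𝐄^{(2)}_{μλ,κν}(X, z)` — PROVED from (I.4.15)₁ in kernel
form in the `y`-slot (`hWy`: `Σ_{y∈W}Σ_ν K_{μν}(x, y)(λ(y + e_ν) − λ(y)) = 0`), by the first antisymmetry for the kernel with its
two slots exchanged. [cite: Balaban1988Convergent, (3.55) p.281] -/
theorem eq355b (K : Fin d → Fin d → X → X → ℝ) (W : Finset X) (shift : Fin d → X → X)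
    (coord : X → Fin d → ℝ) (z : X) {ξ : ℝ} (hξ : ξ ≠ 0)
    (hco : ∀ x ∈ W, ∀ μ κ, coord (shift μ x) κ = coord x κ + if κ = μ then ξ else 0)
    (hWy : ∀ (lam : X → ℝ) (μ : Fin d) (x : X), ∑ y ∈ W, ∑ ν, K μ ν x y * (lam (shift ν y) - lam y) = 0)
    (μ ν κ τ : Fin d) :
    moment2 (W ×ˢ W) K coord z μ ν κ τ = -moment2 (W ×ˢ W) K coord z μ τ κ ν := by
  have h := eq355a (fun a b y x => K b a x y) W shift coord z hξ hco (fun lam a x => hWy lam a x) ν μ τ κ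
  rw [moment2_swap K W coord z μ ν κ τ, moment2_swap K W coord z μ τ κ ν] at h
  exact h

/-- The `y`-slot kernel identity from the `x`-slot one and the symmetry *"𝐄^{(2)}_{μν}(X, x, y, z) = 𝐄^{(2)}_{νμ}(X, y, x, z)"*
(p. 280, after (3.50)). [cite: Balaban1988Convergent, (3.50) p.280] -/
theorem wardY_of_wardX_symm (K : Fin d → Fin d → X → X → ℝ) (W : Finset X) (shift : Fin d → X → X)
    (hsym : ∀ μ ν x y, K μ ν x y = K ν μ y x)
    (hW : ∀ (lam : X → ℝ) (ν : Fin d) (y : X), ∑ x ∈ W, ∑ μ, K μ ν x y * (lam (shift μ x) - lam x) = 0)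
    (lam : X → ℝ) (μ : Fin d) (x : X) :
    ∑ y ∈ W, ∑ ν, K μ ν x y * (lam (shift ν y) - lam y) = 0 := by
  calc ∑ y ∈ W, ∑ ν, K μ ν x y * (lam (shift ν y) - lam y)
      = ∑ y ∈ W, ∑ ν, K ν μ y x * (lam (shift ν y) - lam y) :=
        Finset.sum_congr rfl fun y _ => Finset.sum_congr rfl fun ν _ => by rw [hsym]
    _ = 0 := hW lam μ x

/-- **(3.55), both antisymmetries, from (I.4.15)₁ in the `x`-slot and the symmetry after (3.50)**.
[cite: Balaban1988Convergent, (3.55) p.281] -/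
theorem eq355b_of_symm (K : Fin d → Fin d → X → X → ℝ) (W : Finset X) (shift : Fin d → X → X)
    (coord : X → Fin d → ℝ) (z : X) {ξ : ℝ} (hξ : ξ ≠ 0)
    (hco : ∀ x ∈ W, ∀ μ κ, coord (shift μ x) κ = coord x κ + if κ = μ then ξ else 0)
    (hsym : ∀ μ ν x y, K μ ν x y = K ν μ y x)
    (hW : ∀ (lam : X → ℝ) (ν : Fin d) (y : X), ∑ x ∈ W, ∑ μ, K μ ν x y * (lam (shift μ x) - lam x) = 0)
    (μ ν κ τ : Fin d) :
    moment2 (W ×ˢ W) K coord z μ ν κ τ = -moment2 (W ×ˢ W) K coord z μ τ κ ν :=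
  eq355b K W shift coord z hξ hco (wardY_of_wardX_symm K W shift hsym hW) μ ν κ τ

end KernelAlgebra

/-! ### Consequence for (3.56): the hypotheses (3.55) of `B14.Eq350Kernel.eq356_of_eq349` discharged to (I.4.15)₁ -/

section Display356

variable {d : ℕ} {X : Type*} [Fintype X] [DecidableEq X] {m : Type*} [Fintype m] [DecidableEq m]

attribute [local instance] Matrix.linftyOpNormedAddCommGroup Matrix.linftyOpNormedSpace

omit [DecidableEq X] [DecidableEq m] in
/-- **(3.49) + (I.4.15)₁ ⇒ (3.56)** (pp. 280–281): if (3.49) holds with the kernel table `K` (= `𝐄^{(2)}_{μν}(X, ·, ·, z)`) on the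
window `W ×ˢ W` and irrelevant term `R`, and `K` satisfies the first Ward–Takahashi identity in kernel form (`x`-slot) and the
symmetry after (3.50), then `Σ_{n=1}^{4}(1/n!)⟨𝐄^{(n)}(X, z), ⊗ⁿB⟩ = Σ_{κ<μ, λ<ν} ½𝐄^{(2)}_{μν,κλ}(X, z) tr F_{κμ}(z)F_{λν}(z) +
R` — `B14.Eq350Kernel.eq356_of_eq349` with its hypotheses (3.55) DISCHARGED by `eq355a`/`eq355b_of_symm`.
[cite: Balaban1988Convergent, (3.49) p.280, (3.55)–(3.56) p.281] -/
theorem eq356_of_eq349_of_ward {F : (Fin d × X → Matrix m m ℂ) → ℝ} {B : Fin d × X → Matrix m m ℂ}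
    {K : Fin d → Fin d → X → X → ℝ} {W : Finset X} {coord : X → Fin d → ℝ} {z : X}
    {dB : Fin d → Fin d → Matrix m m ℂ} {Bz : Fin d → Matrix m m ℂ} {R : ℝ}
    (h349 : Eq349 F B K (W ×ˢ W) coord z dB Bz R)
    (shift : Fin d → X → X) {ξ : ℝ} (hξ : ξ ≠ 0)
    (hco : ∀ x ∈ W, ∀ μ κ, coord (shift μ x) κ = coord x κ + if κ = μ then ξ else 0)
    (hsym : ∀ μ ν x y, K μ ν x y = K ν μ y x)
    (hW : ∀ (lam : X → ℝ) (ν : Fin d) (y : X), ∑ x ∈ W, ∑ μ, K μ ν x y * (lam (shift μ x) - lam x) = 0) :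
    taylor4 F B = Eq356FieldStrength.expr356 (moment2 (W ×ˢ W) K coord z) dB Bz + R :=
  eq356_of_eq349 h349 (eq355a K W shift coord z hξ hco hW) (eq355b_of_symm K W shift coord z hξ hco hsym hW)

end Display356

/-! ## §2. (I.4.15)₁ in kernel form from [I]'s abstract Ward–Takahashi identity, scalar bond-field components -/

section FromWard

variable {d : ℕ} {X : Type*} [Fintype X] [DecidableEq X]

/-- Bookkeeping: on the finite configuration space the Hessian at `B = 0` applied to a coordinate direction `δ_{(μ,x)}` and
an arbitrary bond field `w` is the kernel sum `Σ_{y,ν} 𝐄^{(2)}_{μν}(x, y) w_ν(y)` with the printed kernel (3.50)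
`B14.Eq350Kernel.kernel350 F`. [cite: Balaban1988Convergent, (3.50) p.280] -/
theorem hessian_single_apply (F : (Fin d × X → ℝ) → ℝ) (μ : Fin d) (x : X) (w : Fin d × X → ℝ) :
    fderiv ℝ (fderiv ℝ F) 0 (Pi.single (μ, x) 1) w = ∑ y, ∑ ν, kernel350 F μ ν x y * w (ν, y) := by
  calc fderiv ℝ (fderiv ℝ F) 0 (Pi.single (μ, x) 1) w
      = fderiv ℝ (fderiv ℝ F) 0 (Pi.single (μ, x) 1) (∑ q, Pi.single q (w q)) := by
        rw [Finset.univ_sum_single]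
    _ = ∑ q, fderiv ℝ (fderiv ℝ F) 0 (Pi.single (μ, x) 1) (Pi.single q (w q)) := map_sum _ _ _
    _ = ∑ q, w q * kernel350 F μ q.1 x q.2 := by
        refine Finset.sum_congr rfl fun q _ => ?_
        have hq : (Pi.single q (w q) : Fin d × X → ℝ) = w q • Pi.single q (1 : ℝ) := by
          rw [← Pi.single_smul, smul_eq_mul, mul_one]
        rw [hq, map_smul, smul_eq_mul]
        rfl
    _ = ∑ y, ∑ ν, kernel350 F μ ν x y * w (ν, y) := by
        rw [Fintype.sum_prod_type, Finset.sum_comm]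
        exact Finset.sum_congr rfl fun y _ => Finset.sum_congr rfl fun ν _ => by ring

/-- Bookkeeping, other slot: `D²F(0)[w, δ_{(ν,y)}] = Σ_{x,μ} 𝐄^{(2)}_{μν}(x, y) w_μ(x)`. [cite: Balaban1988Convergent, (3.50) p.280] -/
theorem hessian_apply_single (F : (Fin d × X → ℝ) → ℝ) (w : Fin d × X → ℝ) (ν : Fin d) (y : X) :
    fderiv ℝ (fderiv ℝ F) 0 w (Pi.single (ν, y) 1) = ∑ x, ∑ μ, kernel350 F μ ν x y * w (μ, x) := by
  calc fderiv ℝ (fderiv ℝ F) 0 w (Pi.single (ν, y) 1)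
      = fderiv ℝ (fderiv ℝ F) 0 (∑ q, Pi.single q (w q)) (Pi.single (ν, y) 1) := by
        rw [Finset.univ_sum_single]
    _ = ∑ q, fderiv ℝ (fderiv ℝ F) 0 (Pi.single q (w q)) (Pi.single (ν, y) 1) := by
        rw [map_sum, FunLike.coe_sum, Finset.sum_apply]
    _ = ∑ q, w q * kernel350 F q.1 ν q.2 y := by
        refine Finset.sum_congr rfl fun q _ => ?_
        have hq : (Pi.single q (w q) : Fin d × X → ℝ) = w q • Pi.single q (1 : ℝ) := by
          rw [← Pi.single_smul, smul_eq_mul, mul_one]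
        rw [hq, map_smul, FunLike.coe_smul, Pi.smul_apply, smul_eq_mul]
        rfl
    _ = ∑ x, ∑ μ, kernel350 F μ ν x y * w (μ, x) := by
        rw [Fintype.sum_prod_type, Finset.sum_comm]
        exact Finset.sum_congr rfl fun x _ => Finset.sum_congr rfl fun μ _ => by ring

/-- **(I.4.15)₁ ⇒ the kernel form, `y`-slot**: [I] p. 284 *"⟨(δ²/δB²)𝐄(1), B₁, ∂λ⟩ = 0"* in [I]'s abstract form
`B12Ward414.hessian_apply_generator_eq_zero` — `F` twice continuously differentiable at `B = 0`, a generator field `X_λ` of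
the gauge action, differentiable at `0`, with `X_λ(0) = c·∂λ` on the bonds (`(∂λ)_ν(y) = λ(y + e_ν) − λ(y)`; print `c = −1`,
(4.8)–(4.9)), infinitesimal invariance `DF(B)[X_λ(B)] = 0` for `B` near `0` ((4.9)) and (4.14) `DF(0) = 0` — gives, with
`B₁ = δ_{(μ,x)}`: `Σ_{y,ν} 𝐄^{(2)}_{μν}(x, y)(λ(y + e_ν) − λ(y)) = 0`. [cite: Balaban1987RG1, (4.15) p.284] -/
theorem wardY_kernel350 {F : (Fin d × X → ℝ) → ℝ} {Xg : (Fin d × X → ℝ) → (Fin d × X → ℝ)}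
    (hF : ContDiffAt ℝ 2 F 0) (hXg : DifferentiableAt ℝ Xg 0)
    (hinv : ∀ᶠ B in 𝓝 (0 : Fin d × X → ℝ), fderiv ℝ F B (Xg B) = 0) (h414 : fderiv ℝ F 0 = 0)
    (shift : Fin d → X → X) (lam : X → ℝ) {c : ℝ} (hc : c ≠ 0)
    (hX0 : Xg 0 = fun p => c * (lam (shift p.1 p.2) - lam p.2)) (μ : Fin d) (x : X) :
    ∑ y, ∑ ν, kernel350 F μ ν x y * (lam (shift ν y) - lam y) = 0 := by
  have h := B12Ward414.hessian_apply_generator_eq_zero (𝕜 := ℝ) hF hXg hinv h414 (Pi.single (μ, x) 1)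
  rw [hessian_single_apply, hX0] at h
  have e : ∑ y, ∑ ν, kernel350 F μ ν x y * (c * (lam (shift ν y) - lam y))
      = c * ∑ y, ∑ ν, kernel350 F μ ν x y * (lam (shift ν y) - lam y) := by
    rw [Finset.mul_sum]
    refine Finset.sum_congr rfl fun y _ => ?_
    rw [Finset.mul_sum]
    exact Finset.sum_congr rfl fun ν _ => by ring
  rw [e] at h
  exact (mul_eq_zero.1 h).resolve_left hc

/-- **(I.4.15)₁ ⇒ the kernel form, `x`-slot** (the slot used in (3.54)): same hypotheses, second derivatives being symmetric
(`B12Ward414.hessian_generator_apply_eq_zero`): `Σ_{x,μ} 𝐄^{(2)}_{μν}(x, y)(λ(x + e_μ) − λ(x)) = 0` for every `(ν, y)`.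
[cite: Balaban1987RG1, (4.15) p.284] -/
theorem wardX_kernel350 {F : (Fin d × X → ℝ) → ℝ} {Xg : (Fin d × X → ℝ) → (Fin d × X → ℝ)}
    (hF : ContDiffAt ℝ 2 F 0) (hXg : DifferentiableAt ℝ Xg 0)
    (hinv : ∀ᶠ B in 𝓝 (0 : Fin d × X → ℝ), fderiv ℝ F B (Xg B) = 0) (h414 : fderiv ℝ F 0 = 0)
    (shift : Fin d → X → X) (lam : X → ℝ) {c : ℝ} (hc : c ≠ 0)
    (hX0 : Xg 0 = fun p => c * (lam (shift p.1 p.2) - lam p.2)) (ν : Fin d) (y : X) :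
    ∑ x, ∑ μ, kernel350 F μ ν x y * (lam (shift μ x) - lam x) = 0 := by
  have h := B12Ward414.hessian_generator_apply_eq_zero (𝕜 := ℝ) hF hXg hinv h414 (Pi.single (ν, y) 1)
  rw [hessian_apply_single, hX0] at h
  have e : ∑ x, ∑ μ, kernel350 F μ ν x y * (c * (lam (shift μ x) - lam x))
      = c * ∑ x, ∑ μ, kernel350 F μ ν x y * (lam (shift μ x) - lam x) := by
    rw [Finset.mul_sum]
    refine Finset.sum_congr rfl fun x _ => ?_
    rw [Finset.mul_sum]
    exact Finset.sum_congr rfl fun μ _ => by ring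
  rw [e] at h
  exact (mul_eq_zero.1 h).resolve_left hc

/-- **The linear (abelian / linearized) gauge action needs no (4.14)**: if `F` is twice continuously differentiable at `0` and
invariant under the translations `B ↦ B + t·w` for `B` near `0` and real `t` (for `w = ∂λ`: the U(1) reading of [I] (4.7)),
then `D²F(0)[δ_{(μ,x)}, w] = Σ_{y,ν} 𝐄^{(2)}_{μν}(x, y)w_ν(y) = 0` — [I] (4.7) ⇒ (4.9) ⇒ (4.13) with a CONSTANT generator
(`B12Ward414.fderiv_apply_eq_zero_of_const_along`, `B12Ward414.ward_first_order`). [cite: Balaban1987RG1, (4.7)–(4.15) pp.282–284] -/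
theorem wardY_kernel350_of_translate {F : (Fin d × X → ℝ) → ℝ} (hF : ContDiffAt ℝ 2 F 0) (w : Fin d × X → ℝ)
    (hinv : ∀ᶠ B in 𝓝 (0 : Fin d × X → ℝ), ∀ t : ℝ, F (B + t • w) = F B) (μ : Fin d) (x : X) :
    ∑ y, ∑ ν, kernel350 F μ ν x y * w (ν, y) = 0 := by
  -- (4.7) ⇒ (4.9): `DF(B)[w] = 0` for `B` near `0`
  have hdiff : ∀ᶠ B in 𝓝 (0 : Fin d × X → ℝ), DifferentiableAt ℝ F B := by
    filter_upwards [hF.eventually (by simp)] with B hB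
    exact hB.differentiableAt (by simp)
  have h49 : ∀ᶠ B in 𝓝 (0 : Fin d × X → ℝ), fderiv ℝ F B ((fun _ => w) B) = 0 := by
    filter_upwards [hdiff, hinv] with B hB hBinv
    have hγ : HasDerivAt (fun t : ℝ => B + t • w) w 0 := by
      have h1 : HasDerivAt (fun t : ℝ => t • w) ((1 : ℝ) • w) 0 := (hasDerivAt_id (0 : ℝ)).smul_const w
      rw [one_smul] at h1
      exact h1.const_add B
    exact B12Ward414.fderiv_apply_eq_zero_of_const_along (𝕜 := ℝ) (γ := fun t : ℝ => B + t • w)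
      (by simp) hγ hB (Filter.Eventually.of_forall fun t => hBinv t)
  -- (4.9) ⇒ (4.13) with `DX = 0`
  have h := B12Ward414.ward_first_order (𝕜 := ℝ) (X := fun _ => w) hF (differentiableAt_const w) h49
    (Pi.single (μ, x) 1)
  rw [fderiv_const_apply, zero_apply, map_zero, add_zero, hessian_single_apply] at h
  exact h

omit [DecidableEq X] in
/-- Window form: if the kernel is LOCALIZED in the window `W` in its first slot (`𝐄^{(2)}_{μν}(X, x, y, z) = 0` unless `x ∈ W` —
the kernel of a function of the field on the localization domain only), the full-lattice identity is the window identity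
used in §1. [cite: Balaban1988Convergent, (3.50) p.280] -/
theorem wardX_window {K : Fin d → Fin d → X → X → ℝ} (W : Finset X) (hloc : ∀ μ ν x y, x ∉ W → K μ ν x y = 0)
    {shift : Fin d → X → X} {lam : X → ℝ} {ν : Fin d} {y : X}
    (h : ∑ x, ∑ μ, K μ ν x y * (lam (shift μ x) - lam x) = 0) :
    ∑ x ∈ W, ∑ μ, K μ ν x y * (lam (shift μ x) - lam x) = 0 := by
  rw [← h]
  refine Finset.sum_subset (Finset.subset_univ W) fun x _ hx => ?_
  exact Finset.sum_eq_zero fun μ _ => by rw [hloc μ ν x y hx, zero_mul]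

/-- **(3.51) and (3.55) for the printed kernel from [I]'s gauge invariance, assembled**: `F` (scalar bond-field components of
`B ↦ 𝐄^{(j)}(X, U_j(exp iB), z)`) twice continuously differentiable at `0` with (4.14) `DF(0) = 0`, a family of generator
fields `X_λ`, one for every gauge function `λ`, each differentiable at `0` with `X_λ(0) = c·∂λ` (`c ≠ 0`) and `DF(B)[X_λ(B)] = 0`
near `0`; the kernel (3.50) localized in the window `W` (first slot) on which the coordinates are affine along the lattice
shifts.  Then the kernel `K = 𝐄^{(2)}(X, ·, ·, z)` satisfies (3.51) and both antisymmetries (3.55) of its moment table.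
[cite: Balaban1988Convergent, (3.51)–(3.55) pp.280–281] -/
theorem eq355_kernel350_of_ward {F : (Fin d × X → ℝ) → ℝ} (hF : ContDiffAt ℝ 2 F 0) (h414 : fderiv ℝ F 0 = 0)
    (shift : Fin d → X → X) {c : ℝ} (hc : c ≠ 0)
    (Xg : (X → ℝ) → (Fin d × X → ℝ) → (Fin d × X → ℝ)) (hXg : ∀ lam, DifferentiableAt ℝ (Xg lam) 0)
    (hX0 : ∀ lam, Xg lam 0 = fun p => c * (lam (shift p.1 p.2) - lam p.2))
    (hinv : ∀ lam, ∀ᶠ B in 𝓝 (0 : Fin d × X → ℝ), fderiv ℝ F B (Xg lam B) = 0)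
    (W : Finset X) (hloc : ∀ μ ν x y, x ∉ W → kernel350 F μ ν x y = 0)
    (coord : X → Fin d → ℝ) (z : X) {ξ : ℝ} (hξ : ξ ≠ 0)
    (hco : ∀ x ∈ W, ∀ μ κ, coord (shift μ x) κ = coord x κ + if κ = μ then ξ else 0) :
    (∀ ν y μ κ, ∑ x ∈ W, kernel350 F μ ν x y * (coord x κ - coord z κ)
        = -∑ x ∈ W, kernel350 F κ ν x y * (coord x μ - coord z μ)) ∧
    (∀ μ ν κ τ, moment2 (W ×ˢ W) (kernel350 F) coord z μ ν κ τ = -moment2 (W ×ˢ W) (kernel350 F) coord z κ ν μ τ) ∧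
    (∀ μ ν κ τ, moment2 (W ×ˢ W) (kernel350 F) coord z μ ν κ τ = -moment2 (W ×ˢ W) (kernel350 F) coord z μ τ κ ν) := by
  have hW : ∀ (lam : X → ℝ) (ν : Fin d) (y : X),
      ∑ x ∈ W, ∑ μ, kernel350 F μ ν x y * (lam (shift μ x) - lam x) = 0 :=
    fun lam ν y => wardX_window W hloc (wardX_kernel350 hF (hXg lam) (hinv lam) h414 shift lam hc (hX0 lam) ν y)
  have hsym : ∀ μ ν x y, kernel350 F μ ν x y = kernel350 F ν μ y x := fun μ ν x y => kernel350_symm hF μ ν x y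
  exact ⟨fun ν y μ κ => eq351 (kernel350 F) W shift coord z hξ hco hW ν y μ κ,
    fun μ ν κ τ => eq355a (kernel350 F) W shift coord z hξ hco hW μ ν κ τ,
    fun μ ν κ τ => eq355b_of_symm (kernel350 F) W shift coord z hξ hco hsym hW μ ν κ τ⟩

end FromWard

end Literature.MathematicalPhysics.QuantumFieldTheory.Balaban1983to89.B14.Lem280Ward
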